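import Literature.Geometry.Riemannian.RiemVolumeImageLe
import Literature.Geometry.Riemannian.RicciNonnegInfiniteVolumeProofs
import HarnessLib

/-!
# The area formula, inequality half, for `C¹` self-maps of a Riemannian manifold with a frame
# bound on the Jacobian: `Vol_g(Φ(S)) ≤ ∫_S J dVol_g`

Topic `Geometry/Riemannian`. For a Riemannian `m`-manifold `(M, h)` modelled on `ℝᵐ` (second
countable), a continuous map `Φ : M → M` differentiable at the points of a measurable `S ⊆ M`,
and a measurable `J : M → [0, ∞]` such that at every `x ∈ S` the differential `dΦ_x` has, in SOME
`h`-orthonormal bases `e` of `T_xM` and `ε` of `T_{Φx}M`, a matrix `A` (`dΦ_x e_k = ∑ᵢ A_{ik} εᵢ`)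
with `|det A| ≤ J x`, we prove, WITHOUT injectivity of `Φ`,

  `μ_h (Φ '' S) ≤ ∫⁻_S J dμ_h`      (`riemannianMeasure_image_le_lintegral_of_frame`).

This is the step "`|{p : d(x,p) < r ∀ x ∈ D}| ≤ ∫_{A_r} |det DΦ_r(x)| dvol(x)`" of S. Brendle's ABP
proof of the sharp Sobolev inequality (CPAM 76 (2023), §2, proof of Thm. 1.1, with Lemma 2.2 and
Cor. 2.6: the Jacobian bound is available only ON the contact set `A_r`, in orthonormal frames),
i.e. the inequality half of the area formula (Federer 1969, §3.2.3, §3.2.5, §3.2.46) for maps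
between manifolds, reduced to the tree's Euclidean-domain version (`RiemVolumeImageLe.lean`):

* `gram_bilin_eq_transpose_mul` — Gram matrix of vectors expanded in a `B`-orthonormal family;
* `abs_det_fderiv_chart_conj_mul_sqrt_det_eq` — **frame Jacobian = chart Jacobian**: for
  `u ∈ φ_p.target`, `x = φ_p⁻¹ u`, `Φ x ∈ φ_q.source`,
  `|det D(φ_q ∘ Φ ∘ φ_p⁻¹)(u)| √det h^{q}_{ij}(φ_q(Φ x)) = |det A| √det h^{p}_{ij}(u)`
  (`abs_det_fderiv_comp_mul_sqrt_det_chartGramMatrix` for `Φ ∘ φ_p⁻¹`, the chain rule, and two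
  changes of Gram basis `sqrt_det_gram_comp` from the coordinate basis to the frame `e`);
* `riemannianMeasure_image_le_lintegral_of_frame_piece` — one piece
  `T ⊆ φ_p.source ∩ Φ⁻¹ φ_q.source`: `μ_h(Φ T) = μ_h((Φ∘φ_p⁻¹)(φ_p T))`
  `≤ ∫_{φ_p T} |det D(φ_q∘Φ∘φ_p⁻¹)| √det h^q ≤ ∫_{φ_p T} J∘φ_p⁻¹ √det h^p = ∫_T J dμ_h`
  (chart form of `μ_h`, `map_extChartAt_restrict_riemannianMeasure`,
  `lintegral_image_le_lintegral_abs_det_fderiv_mul`, `setLIntegral_extChartAt_comp`);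
* `riemannianMeasure_image_le_lintegral_of_frame` — countably many pairs of charts, disjointified.

Pure measure theory on the tree's volume/chart infrastructure; no definitions, no named facts.

## References

* H. Federer, *Geometric Measure Theory*, Springer 1969, §3.2.3, §3.2.5, §3.2.46. [Federer1969]
* [Brendle2022] S. Brendle, CPAM 76 (2023) 2192–2218 (arXiv:2009.13717), §2, proof of Thm. 1.1
  (the display after Cor. 2.6). READ.
-/

noncomputable section

open Bundle Set Function Filter MeasureTheory Manifold
open scoped Manifold ContDiff Topology ENNReal NNReal Matrix

namespace Literature.Geometry.Riemannian

open Lorentzian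

/-! ### Linear algebra: Gram matrices in orthonormal frames -/

section LinearAlgebra

variable {V : Type*} [NormedAddCommGroup V] [NormedSpace ℝ V]

/-- **Gram matrix in a `B`-orthonormal family**: if `v_k = ∑ᵢ A_{ik} eᵢ` with `B(eᵢ, eⱼ) = δᵢⱼ`,
then `(B(v_k, v_l))_{kl} = Aᵀ A`. [folklore] -/
theorem gram_bilin_eq_transpose_mul {ι κ : Type*} [Fintype ι] [DecidableEq ι]
    (B : V →L[ℝ] V →L[ℝ] ℝ) {e : ι → V} (hon : ∀ i j, B (e i) (e j) = if i = j then 1 else 0)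
    (A : Matrix ι κ ℝ) {v : κ → V} (hv : ∀ k, v k = ∑ i, A i k • e i) :
    (Matrix.of fun k l ↦ B (v k) (v l)) = Aᵀ * A := by
  ext k l
  simp only [Matrix.of_apply, Matrix.mul_apply, Matrix.transpose_apply, hv, map_sum, map_smul,
    FunLike.coe_sum, FunLike.coe_smul, Finset.sum_apply, Pi.smul_apply, smul_eq_mul, hon,
    mul_ite, mul_one, mul_zero, Finset.sum_ite_eq', Finset.mem_univ, if_true]
  exact Finset.sum_congr rfl fun i _ ↦ mul_comm _ _

end LinearAlgebra

/-! ### The chart Jacobian of a self-map against its frame Jacobian -/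

section FrameJacobian

variable {H : Type*} [TopologicalSpace H] {n : ℕ∞ω} {m : ℕ}
  {I : ModelWithCorners ℝ (EuclideanSpace ℝ (Fin m)) H} [I.Boundaryless]
  {N : Type*} [TopologicalSpace N] [ChartedSpace H N] [IsManifold I 1 N]
  (h : ContMDiffRiemannianMetric I n (EuclideanSpace ℝ (Fin m)) (TangentSpace I : N → Type _))

/-- **Frame Jacobian versus chart Jacobian** (Lee 2018, Prop. 2.41 ff.; Federer 1969, §3.2.46:
independence of `√det g dx` of the chart, here for a map). Let `u ∈ φ_p.target`, `x = φ_p⁻¹ u`,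
`Φ` differentiable at `x` with `Φ x ∈ φ_q.source`, and suppose `dΦ_x e_k = ∑ᵢ A_{ik} εᵢ` for
`h`-orthonormal bases `e` of `T_xM`, `ε` of `T_{Φ x}M`. Then
`|det D(φ_q ∘ Φ ∘ φ_p⁻¹)(u)| · √det (h^q_{ij})(φ_q (Φ x)) = |det A| · √det (h^p_{ij})(u)`:
the left side is `√det (h(dΦ bᵢ, dΦ bⱼ))` for the coordinate basis `bᵢ = d(φ_p⁻¹)_u eᵢ`
(`abs_det_fderiv_comp_mul_sqrt_det_chartGramMatrix`, chain rule), `(h^p_{ij})(u) = (h(bᵢ, bⱼ))` by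
definition, and both Gram determinants are read in the frame `e` (`sqrt_det_gram_comp`,
`gram_bilin_eq_transpose_mul`). The point is written as `φ_p⁻¹ u` throughout (no transport of
tangent vectors along `φ_p⁻¹(φ_p x) = x` is needed by users). [cite: Federer1969, §3.2.46] -/
theorem abs_det_fderiv_chart_conj_mul_sqrt_det_eq (Φ : N → N) (p q : N)
    {u : EuclideanSpace ℝ (Fin m)} (hu : u ∈ (extChartAt I p).target)
    (hxq : Φ ((extChartAt I p).symm u) ∈ (extChartAt I q).source)
    (hΦ : MDifferentiableAt I I Φ ((extChartAt I p).symm u))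
    {e : Fin m → TangentSpace I ((extChartAt I p).symm u)}
    {ε : Fin m → TangentSpace I (Φ ((extChartAt I p).symm u))}
    (he : ∀ i j, h.inner ((extChartAt I p).symm u) (e i) (e j) = if i = j then 1 else 0)
    (hε : ∀ i j, h.inner (Φ ((extChartAt I p).symm u)) (ε i) (ε j) = if i = j then 1 else 0)
    (A : Matrix (Fin m) (Fin m) ℝ)
    (hA : ∀ k, mfderiv I I Φ ((extChartAt I p).symm u) (e k) = ∑ i, A i k • ε i) :
    |(fderiv ℝ (fun z ↦ extChartAt I q (Φ ((extChartAt I p).symm z))) u).det| *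
        Real.sqrt (chartGramMatrix h q (extChartAt I q (Φ ((extChartAt I p).symm u)))).det =
      |A.det| * Real.sqrt (chartGramMatrix h p u).det := by
  classical
  -- differentiability of `c⁻¹` at `u` and of `F = Φ ∘ c⁻¹`
  have hsd : MDifferentiableAt 𝓘(ℝ, EuclideanSpace ℝ (Fin m)) I (extChartAt I p).symm u := by
    have := mdifferentiableWithinAt_extChartAt_symm (I := I) hu
    rwa [ModelWithCorners.range_eq_univ, mdifferentiableWithinAt_univ] at this
  set F : EuclideanSpace ℝ (Fin m) → N := fun z ↦ Φ ((extChartAt I p).symm z) with hF_def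
  have hF : MDifferentiableAt 𝓘(ℝ, EuclideanSpace ℝ (Fin m)) I F u := hΦ.comp u hsd
  have hFu : F u = Φ ((extChartAt I p).symm u) := rfl
  -- the chart identity for `F` in the chart at `q`
  have key := abs_det_fderiv_comp_mul_sqrt_det_chartGramMatrix h F q hF hxq
  -- chain rule: `dF_u(v) = dΦ_x(d(c⁻¹)_u v)`
  set b : Fin m → TangentSpace I ((extChartAt I p).symm u) := fun i ↦
    mfderiv 𝓘(ℝ, EuclideanSpace ℝ (Fin m)) I (extChartAt I p).symm u (EuclideanSpace.single i 1)
    with hb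
  set dΦ : EuclideanSpace ℝ (Fin m) →L[ℝ] EuclideanSpace ℝ (Fin m) :=
    mfderiv I I Φ ((extChartAt I p).symm u) with hdΦ
  have hchain : ∀ i, mfderiv 𝓘(ℝ, EuclideanSpace ℝ (Fin m)) I F u (EuclideanSpace.single i 1) =
      dΦ (b i) := by
    intro i
    have hcomp : mfderiv 𝓘(ℝ, EuclideanSpace ℝ (Fin m)) I F u =
        dΦ.comp (mfderiv 𝓘(ℝ, EuclideanSpace ℝ (Fin m)) I (extChartAt I p).symm u) :=
      mfderiv_comp u hΦ hsd
    rw [hcomp]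
    rfl
  -- the chart Gram matrix at `u` is the Gram matrix of the coordinate vectors `b`
  have hchart : chartGramMatrix h p u =
      Matrix.of fun i j ↦ h.inner ((extChartAt I p).symm u) (b i) (b j) := by
    ext i j
    simp only [chartGramMatrix, Matrix.of_apply, ModelWithCorners.range_eq_univ,
      mfderivWithin_univ]
    rfl
  -- the basis `e` of `E = T_x N` and the endomorphism `L e_i = b_i`
  have hcard : Fintype.card (Fin m) = Module.finrank ℝ (EuclideanSpace ℝ (Fin m)) := by
    rw [finrank_euclideanSpace_fin, Fintype.card_fin]
  set eE : Fin m → EuclideanSpace ℝ (Fin m) := fun i ↦ e i with heE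
  have heE_apply : ∀ i, eE i = e i := fun i ↦ rfl
  have hli : LinearIndependent ℝ eE :=
    linearIndependent_of_bilin_orthonormal (V := EuclideanSpace ℝ (Fin m))
      (h.inner ((extChartAt I p).symm u)) he
  have hsp : ⊤ ≤ Submodule.span ℝ (Set.range eE) :=
    (hli.span_eq_top_of_card_eq_finrank' hcard).ge
  set bE : Module.Basis (Fin m) ℝ (EuclideanSpace ℝ (Fin m)) := Module.Basis.mk hli hsp with hbE
  have hbE_apply : ∀ i, bE i = e i := fun i ↦ by rw [hbE, Module.Basis.mk_apply]
  set L : EuclideanSpace ℝ (Fin m) →ₗ[ℝ] EuclideanSpace ℝ (Fin m) :=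
    bE.constr ℝ (fun i ↦ (b i : EuclideanSpace ℝ (Fin m))) with hL
  have hLe : ∀ i, L (bE i) = b i := fun i ↦ bE.constr_basis ℝ _ i
  -- the two bilinear forms on `E`
  set B₁ : LinearMap.BilinForm ℝ (EuclideanSpace ℝ (Fin m)) := LinearMap.BilinForm.comp
    (h.inner (Φ ((extChartAt I p).symm u)) :
      EuclideanSpace ℝ (Fin m) →L[ℝ] EuclideanSpace ℝ (Fin m) →L[ℝ] ℝ).toLinearMap₁₂
    (dΦ : EuclideanSpace ℝ (Fin m) →ₗ[ℝ] EuclideanSpace ℝ (Fin m))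
    (dΦ : EuclideanSpace ℝ (Fin m) →ₗ[ℝ] EuclideanSpace ℝ (Fin m)) with hB₁
  have hB₁_apply : ∀ v w, B₁ v w = h.inner (Φ ((extChartAt I p).symm u)) (dΦ v) (dΦ w) :=
    fun v w ↦ rfl
  set B₂ : LinearMap.BilinForm ℝ (EuclideanSpace ℝ (Fin m)) :=
    (h.inner ((extChartAt I p).symm u) :
      EuclideanSpace ℝ (Fin m) →L[ℝ] EuclideanSpace ℝ (Fin m) →L[ℝ] ℝ).toLinearMap₁₂ with hB₂
  have hB₂_apply : ∀ v w, B₂ v w = h.inner ((extChartAt I p).symm u) v w := fun v w ↦ rfl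
  -- `G₁ = (B₁(L e_i, L e_j))`, `√det G₁ = |det L| |det A|`
  have hG₁ : (Matrix.of fun i j ↦ h.inner (F u)
      (mfderiv 𝓘(ℝ, EuclideanSpace ℝ (Fin m)) I F u (EuclideanSpace.single i 1))
      (mfderiv 𝓘(ℝ, EuclideanSpace ℝ (Fin m)) I F u (EuclideanSpace.single j 1))) =
      Matrix.of fun i j ↦ B₁ (L (bE i)) (L (bE j)) := by
    ext i j
    rw [Matrix.of_apply, Matrix.of_apply, hB₁_apply, hLe, hLe, hchain, hchain]
  have hAe : (Matrix.of fun i j ↦ B₁ (bE i) (bE j)) = Aᵀ * A := by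
    have h1 : (Matrix.of fun i j ↦ B₁ (bE i) (bE j)) =
        Matrix.of fun k l ↦ h.inner (Φ ((extChartAt I p).symm u)) (dΦ (e k)) (dΦ (e l)) := by
      ext i j; rw [Matrix.of_apply, Matrix.of_apply, hB₁_apply, hbE_apply, hbE_apply]
    rw [h1]
    exact gram_bilin_eq_transpose_mul (V := EuclideanSpace ℝ (Fin m))
      (h.inner (Φ ((extChartAt I p).symm u))) hε A hA
  have hsqrt₁ : Real.sqrt (Matrix.of fun i j ↦ h.inner (F u)
      (mfderiv 𝓘(ℝ, EuclideanSpace ℝ (Fin m)) I F u (EuclideanSpace.single i 1))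
      (mfderiv 𝓘(ℝ, EuclideanSpace ℝ (Fin m)) I F u (EuclideanSpace.single j 1))).det =
      |LinearMap.det L| * |A.det| := by
    rw [hG₁, sqrt_det_gram_comp bE B₁ L, hAe, Matrix.det_mul, Matrix.det_transpose,
      Real.sqrt_mul_self_eq_abs]
  -- `G₂ = chartGramMatrix = (B₂(L e_i, L e_j))`, `√det G₂ = |det L|`
  have hG₂ : chartGramMatrix h p u = Matrix.of fun i j ↦ B₂ (L (bE i)) (L (bE j)) := by
    rw [hchart]
    ext i j
    rw [Matrix.of_apply, Matrix.of_apply, hB₂_apply, hLe, hLe]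
  have hone : (Matrix.of fun i j ↦ B₂ (bE i) (bE j)) = 1 := by
    ext i j
    rw [Matrix.of_apply, hB₂_apply, hbE_apply, hbE_apply, he, Matrix.one_apply]
  have hsqrt₂ : Real.sqrt (chartGramMatrix h p u).det = |LinearMap.det L| := by
    rw [hG₂, sqrt_det_gram_comp bE B₂ L, hone, Matrix.det_one, Real.sqrt_one, mul_one]
  rw [key, hsqrt₁, hsqrt₂, mul_comm]

end FrameJacobian


/-! ### The area inequality for self-maps of a Riemannian manifold -/

section AreaInequality

variable {m : ℕ} {M : Type*} [TopologicalSpace M] [ChartedSpace (EuclideanSpace ℝ (Fin m)) M]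
  [IsManifold (𝓡 m) 1 M] [T3Space M] [MeasurableSpace M] [BorelSpace M] {n : ℕ∞ω}
  (h : ContMDiffRiemannianMetric (𝓡 m) n (EuclideanSpace ℝ (Fin m))
    (TangentSpace (𝓡 m) : M → Type _))

/-- **Area inequality with a frame bound, one piece.** For `T ⊆ φ_p.source ∩ Φ⁻¹(φ_q.source)`
measurable, `Φ` differentiable at the points of `T`, `J` measurable, and the frame bound
`|det A| ≤ J x` at every `x ∈ T` (in some orthonormal bases), `μ_h (Φ '' T) ≤ ∫⁻_T J dμ_h`:
`Φ '' T = (Φ ∘ φ_p⁻¹) '' (φ_p '' T)`; through the chart at `q`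
(`map_extChartAt_restrict_riemannianMeasure`) and the Euclidean inequality
`lintegral_image_le_lintegral_abs_det_fderiv_mul` the measure is at most
`∫_{φ_p T} |det D(φ_q∘Φ∘φ_p⁻¹)| √det h^q`, whose integrand is
`|det A| √det h^p ≤ (J∘φ_p⁻¹) √det h^p`
(`abs_det_fderiv_chart_conj_mul_sqrt_det_eq`), and `∫_{φ_p T} (J∘φ_p⁻¹) √det h^p = ∫_T J dμ_h`
(`setLIntegral_extChartAt_comp`). Federer 1969, §3.2.3, §3.2.46.
[cite: Federer1969, §3.2.3 and §3.2.46] -/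
theorem riemannianMeasure_image_le_lintegral_of_frame_piece (Φ : M → M) (p q : M)
    {T : Set M} (hT : MeasurableSet T) (hTp : T ⊆ (extChartAt (𝓡 m) p).source)
    (hTq : T ⊆ Φ ⁻¹' (extChartAt (𝓡 m) q).source)
    (hΦd : ∀ x ∈ T, MDifferentiableAt (𝓡 m) (𝓡 m) Φ x) {J : M → ℝ≥0∞} (hJm : Measurable J)
    (hJ : ∀ x ∈ T, ∃ (e : Fin m → TangentSpace (𝓡 m) x) (ε : Fin m → TangentSpace (𝓡 m) (Φ x))
      (A : Matrix (Fin m) (Fin m) ℝ),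
      (∀ i j, h.inner x (e i) (e j) = if i = j then 1 else 0) ∧
      (∀ i j, h.inner (Φ x) (ε i) (ε j) = if i = j then 1 else 0) ∧
      (∀ k, mfderiv (𝓡 m) (𝓡 m) Φ x (e k) = ∑ i, A i k • ε i) ∧
      ENNReal.ofReal |A.det| ≤ J x) :
    riemannianMeasure h (Φ '' T) ≤ ∫⁻ x in T, J x ∂riemannianMeasure h := by
  classical
  set c := extChartAt (𝓡 m) p with hc
  set T' : Set (EuclideanSpace ℝ (Fin m)) := c '' T with hT'
  have hT'm : MeasurableSet T' := measurableSet_image_extChartAt p hT hTp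
  have hT't : T' ⊆ c.target := by
    rintro _ ⟨x, hx, rfl⟩; exact c.map_source (hTp hx)
  set F : EuclideanSpace ℝ (Fin m) → M := fun z ↦ Φ (c.symm z) with hF
  -- `Φ '' T = F '' T'`
  have himage : Φ '' T = F '' T' := by
    rw [hT', image_image]
    refine image_congr fun x hx ↦ ?_
    show Φ x = Φ (c.symm (c x))
    rw [c.left_inv (hTp hx)]
  -- the chart at `q`
  have hU : MeasurableSet (extChartAt (𝓡 m) q).source :=
    (isOpen_extChartAt_source q).measurableSet
  have ht : MeasurableSet (extChartAt (𝓡 m) q).target := measurableSet_extChartAt_target q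
  obtain ⟨ρ, hρm, hρ⟩ : ∃ ρ : EuclideanSpace ℝ (Fin m) → ℝ≥0∞, Measurable ρ ∧
      EqOn ρ (fun y ↦ ENNReal.ofReal (Real.sqrt (chartGramMatrix h q y).det))
        (extChartAt (𝓡 m) q).target := by
    refine ⟨(extChartAt (𝓡 m) q).target.piecewise
      (fun y ↦ ENNReal.ofReal (Real.sqrt (chartGramMatrix h q y).det)) 0, ?_,
      piecewise_eqOn _ _ _⟩
    exact (ENNReal.continuous_ofReal.comp_continuousOn
      (continuousOn_sqrt_det_chartGramMatrix h q)).measurable_piecewise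
      continuous_zero.continuousOn ht
  have hρae : (fun y ↦ ENNReal.ofReal (Real.sqrt (chartGramMatrix h q y).det)) =ᵐ[volume.restrict
      (extChartAt (𝓡 m) q).target] ρ := by
    filter_upwards [ae_restrict_mem ht] with y hy
    exact (hρ hy).symm
  have hFT : F '' T' ⊆ (extChartAt (𝓡 m) q).source := by
    rw [← himage]
    rintro _ ⟨x, hx, rfl⟩; exact hTq hx
  -- Step A: through the chart at `q`, `μ_h (F '' T') ≤ ∫⁻_{(φ_q ∘ F) '' T'} ρ`
  have hA : riemannianMeasure h (F '' T') ≤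
      ∫⁻ y in ((extChartAt (𝓡 m) q) ∘ F) '' T', ρ y := by
    calc riemannianMeasure h (F '' T')
        = (riemannianMeasure h).restrict (extChartAt (𝓡 m) q).source (F '' T') := by
          rw [Measure.restrict_apply' hU, inter_eq_left.2 hFT]
      _ ≤ (riemannianMeasure h).restrict (extChartAt (𝓡 m) q).source
            ((extChartAt (𝓡 m) q) ⁻¹' (((extChartAt (𝓡 m) q) ∘ F) '' T')) := by
          refine measure_mono ?_
          rw [image_comp]
          exact subset_preimage_image _ _
      _ ≤ ((riemannianMeasure h).restrict (extChartAt (𝓡 m) q).source).map (extChartAt (𝓡 m) q)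
            (((extChartAt (𝓡 m) q) ∘ F) '' T') :=
          Measure.le_map_apply (aemeasurable_extChartAt_restrict q _) _
      _ = ((volume.restrict (extChartAt (𝓡 m) q).target).withDensity ρ)
            (((extChartAt (𝓡 m) q) ∘ F) '' T') := by
          rw [map_extChartAt_restrict_riemannianMeasure h q, withDensity_congr_ae hρae]
      _ = ∫⁻ y in ((extChartAt (𝓡 m) q) ∘ F) '' T', ρ y
            ∂(volume.restrict (extChartAt (𝓡 m) q).target) := withDensity_apply' _ _
      _ ≤ ∫⁻ y in ((extChartAt (𝓡 m) q) ∘ F) '' T', ρ y :=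
          lintegral_mono' (Measure.restrict_mono subset_rfl Measure.restrict_le_self) le_rfl
  -- Step B: the Euclidean inequality for `f = φ_q ∘ F` on `T'`
  have hFd : ∀ u ∈ T', MDifferentiableAt 𝓘(ℝ, EuclideanSpace ℝ (Fin m)) (𝓡 m) F u := by
    rintro _ ⟨x, hx, rfl⟩
    have hsd : MDifferentiableAt 𝓘(ℝ, EuclideanSpace ℝ (Fin m)) (𝓡 m) c.symm (c x) := by
      have := mdifferentiableWithinAt_extChartAt_symm (I := 𝓡 m) (c.map_source (hTp hx))
      rwa [ModelWithCorners.range_eq_univ, mdifferentiableWithinAt_univ] at this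
    have hΦ' : MDifferentiableAt (𝓡 m) (𝓡 m) Φ (c.symm (c x)) := by
      rw [c.left_inv (hTp hx)]; exact hΦd x hx
    exact hΦ'.comp (c x) hsd
  have hderiv : ∀ u ∈ T', HasFDerivWithinAt ((extChartAt (𝓡 m) q) ∘ F)
      (fderiv ℝ ((extChartAt (𝓡 m) q) ∘ F) u) T' u := by
    intro u hu
    have hφ : MDifferentiableAt (𝓡 m) 𝓘(ℝ, EuclideanSpace ℝ (Fin m)) (extChartAt (𝓡 m) q)
        (F u) :=
      mdifferentiableAt_extChartAt (by
        rw [← extChartAt_source (𝓡 m)]; exact hFT (mem_image_of_mem F hu))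
    have h1 : MDifferentiableAt 𝓘(ℝ, EuclideanSpace ℝ (Fin m)) 𝓘(ℝ, EuclideanSpace ℝ (Fin m))
        ((extChartAt (𝓡 m) q) ∘ F) u := hφ.comp u (hFd u hu)
    exact (mdifferentiableAt_iff_differentiableAt.1 h1).hasFDerivAt.hasFDerivWithinAt
  have hB := lintegral_image_le_lintegral_abs_det_fderiv_mul volume hT'm hderiv hρm
  -- Step C: pointwise, the integrand is `|det A| ρ_p(u) ≤ J(c⁻¹ u) ρ_p(u)` on `T'`
  have hC : ∀ u ∈ T', ENNReal.ofReal |(fderiv ℝ ((extChartAt (𝓡 m) q) ∘ F) u).det| *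
      ρ (((extChartAt (𝓡 m) q) ∘ F) u) ≤
      J (c.symm u) * ENNReal.ofReal (Real.sqrt (chartGramMatrix h p u).det) := by
    rintro _ ⟨x, hx, rfl⟩
    have hy : c.symm (c x) = x := c.left_inv (hTp hx)
    have hyT : c.symm (c x) ∈ T := by rw [hy]; exact hx
    obtain ⟨e, ε, A, he, hε, hAe, hdet⟩ := hJ (c.symm (c x)) hyT
    have hxq : Φ (c.symm (c x)) ∈ (extChartAt (𝓡 m) q).source := hTq hyT
    have hΦ' : MDifferentiableAt (𝓡 m) (𝓡 m) Φ (c.symm (c x)) := hΦd _ hyT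
    have hu : c x ∈ c.target := c.map_source (hTp hx)
    have key := abs_det_fderiv_chart_conj_mul_sqrt_det_eq h Φ p q hu hxq hΦ' he hε A hAe
    have htgt : (extChartAt (𝓡 m) q) (Φ (c.symm (c x))) ∈ (extChartAt (𝓡 m) q).target :=
      (extChartAt (𝓡 m) q).map_source hxq
    rw [Function.comp_apply, show F (c x) = Φ (c.symm (c x)) from rfl, hρ htgt,
      ← ENNReal.ofReal_mul (abs_nonneg _)]
    rw [show ((extChartAt (𝓡 m) q) ∘ F) = (fun z ↦ extChartAt (𝓡 m) q (Φ (c.symm z))) from rfl,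
      key, ENNReal.ofReal_mul (abs_nonneg _)]
    exact mul_le_mul' hdet le_rfl
  -- Step D: the right-hand side is `∫⁻_T J dμ_h` (chart formula for the Riemannian measure)
  have hD : ∫⁻ u in T', J (c.symm u) * ENNReal.ofReal (Real.sqrt (chartGramMatrix h p u).det) =
      ∫⁻ x in T, J x ∂riemannianMeasure h := by
    have hsrc : MeasurableSet c.source := (isOpen_extChartAt_source p).measurableSet
    have hg : AEMeasurable (T'.indicator (J ∘ c.symm))
        ((volume : Measure (EuclideanSpace ℝ (Fin m))).restrict c.target) :=
      ((hJm.comp_aemeasurable (aemeasurable_extChartAt_symm_restrict p))).indicator hT'm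
    have h1 := setLIntegral_extChartAt_comp h p hg
    -- left side of `h1` is `∫⁻_T J dμ_h`
    have h2 : ∫⁻ x in c.source, T'.indicator (J ∘ c.symm) (c x) ∂riemannianMeasure h =
        ∫⁻ x in T, J x ∂riemannianMeasure h := by
      rw [← lintegral_indicator hT, ← setLIntegral_eq_of_support_subset
        (μ := riemannianMeasure h) (f := T.indicator J) (s := c.source)
        (support_indicator_subset.trans hTp)]
      refine setLIntegral_congr_fun hsrc fun x hx ↦ ?_
      by_cases hxT : x ∈ T
      · rw [indicator_of_mem (mem_image_of_mem c hxT), indicator_of_mem hxT,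
          Function.comp_apply, c.left_inv hx]
      · rw [indicator_of_notMem hxT, indicator_of_notMem]
        rintro ⟨x', hx'T, hx'⟩
        exact hxT (by rwa [← c.injOn (hTp hx'T) hx hx'])
    -- right side of `h1` is the integral over `T'`
    have h3 : ∫⁻ y in c.target, T'.indicator (J ∘ c.symm) y *
        ENNReal.ofReal (Real.sqrt (chartGramMatrix h p y).det) =
        ∫⁻ u in T', J (c.symm u) * ENNReal.ofReal (Real.sqrt (chartGramMatrix h p u).det) := by
      have : (fun y ↦ T'.indicator (J ∘ c.symm) y *
          ENNReal.ofReal (Real.sqrt (chartGramMatrix h p y).det)) =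
          T'.indicator (fun y ↦ J (c.symm y) *
            ENNReal.ofReal (Real.sqrt (chartGramMatrix h p y).det)) := by
        funext y
        by_cases hy : y ∈ T'
        · simp only [indicator_of_mem hy, Function.comp_apply]
        · simp only [indicator_of_notMem hy, zero_mul]
      rw [this, lintegral_indicator hT'm, Measure.restrict_restrict hT'm,
        inter_eq_left.2 hT't]
    rw [← h3, ← h1, h2]
  -- conclusion
  calc riemannianMeasure h (Φ '' T) = riemannianMeasure h (F '' T') := by rw [himage]
    _ ≤ ∫⁻ y in ((extChartAt (𝓡 m) q) ∘ F) '' T', ρ y := hA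
    _ ≤ ∫⁻ u in T', ENNReal.ofReal |(fderiv ℝ ((extChartAt (𝓡 m) q) ∘ F) u).det| *
        ρ (((extChartAt (𝓡 m) q) ∘ F) u) := hB
    _ ≤ ∫⁻ u in T', J (c.symm u) * ENNReal.ofReal (Real.sqrt (chartGramMatrix h p u).det) :=
        setLIntegral_mono' hT'm fun u hu ↦ hC u hu
    _ = ∫⁻ x in T, J x ∂riemannianMeasure h := hD


/-- **The area formula, inequality half, for self-maps with a frame bound on the Jacobian**
(Federer 1969, §3.2.3, §3.2.5, §3.2.46; the step `|Φ_r(A_r)| ≤ ∫_{A_r} |det DΦ_r|` of Brendle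
2023, proof of Thm. 1.1). Let `(M, h)` be a second countable Riemannian manifold modelled on
`ℝᵐ`, `Φ : M → M` continuous and differentiable at the points of a measurable set `S`, and
`J : M → [0, ∞]` measurable such that for every `x ∈ S` there are `h`-orthonormal bases `e` of
`T_xM`, `ε` of `T_{Φx}M` and a matrix `A` with `dΦ_x e_k = ∑ᵢ A_{ik} εᵢ` and `|det A| ≤ J x`. Then
`μ_h (Φ '' S) ≤ ∫⁻_S J dμ_h` (no injectivity): cover by countably many pairs of chart domains,
disjointify, apply `riemannianMeasure_image_le_lintegral_of_frame_piece` and sum.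
[cite: Federer1969, §3.2.3 and §3.2.46] [cite: Brendle2022, Thm. 1.1 (proof)] -/
theorem riemannianMeasure_image_le_lintegral_of_frame [SecondCountableTopology M] {Φ : M → M}
    (hΦc : Continuous Φ) {S : Set M} (hS : MeasurableSet S)
    (hΦd : ∀ x ∈ S, MDifferentiableAt (𝓡 m) (𝓡 m) Φ x) {J : M → ℝ≥0∞} (hJm : Measurable J)
    (hJ : ∀ x ∈ S, ∃ (e : Fin m → TangentSpace (𝓡 m) x) (ε : Fin m → TangentSpace (𝓡 m) (Φ x))
      (A : Matrix (Fin m) (Fin m) ℝ),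
      (∀ i j, h.inner x (e i) (e j) = if i = j then 1 else 0) ∧
      (∀ i j, h.inner (Φ x) (ε i) (ε j) = if i = j then 1 else 0) ∧
      (∀ k, mfderiv (𝓡 m) (𝓡 m) Φ x (e k) = ∑ i, A i k • ε i) ∧
      ENNReal.ofReal |A.det| ≤ J x) :
    riemannianMeasure h (Φ '' S) ≤ ∫⁻ x in S, J x ∂riemannianMeasure h := by
  classical
  rcases isEmpty_or_nonempty M with hM | hM
  · rw [eq_empty_of_isEmpty (Φ '' S), measure_empty]; exact zero_le
  obtain ⟨q, hq⟩ := exists_seq_mem_extChartAt_source (m := m) (M := M)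
  -- the pieces `S ∩ φ_{q k}.source ∩ Φ ⁻¹' φ_{q l}.source`, indexed by `ℕ` through `Nat.unpair`
  set P : ℕ → Set M := fun n ↦ S ∩ (extChartAt (𝓡 m) (q (Nat.unpair n).1)).source ∩
    Φ ⁻¹' (extChartAt (𝓡 m) (q (Nat.unpair n).2)).source with hP
  have hPm : ∀ n, MeasurableSet (P n) := fun n ↦
    (hS.inter (isOpen_extChartAt_source _).measurableSet).inter
      (((isOpen_extChartAt_source _).preimage hΦc).measurableSet)
  have hPS : (⋃ n, P n) = S := by
    refine Subset.antisymm (iUnion_subset fun n ↦ inter_subset_left.trans inter_subset_left)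
      fun x hx ↦ ?_
    obtain ⟨k, hk⟩ := hq x
    obtain ⟨l, hl⟩ := hq (Φ x)
    refine mem_iUnion.2 ⟨Nat.pair k l, ?_⟩
    simp only [hP, Nat.unpair_pair]
    exact ⟨⟨hx, hk⟩, hl⟩
  set D : ℕ → Set M := disjointed P with hD
  have hDm : ∀ n, MeasurableSet (D n) := MeasurableSet.disjointed hPm
  have hDS : (⋃ n, D n) = S := by rw [hD, iUnion_disjointed, hPS]
  have hDP : ∀ n, D n ⊆ P n := fun n ↦ disjointed_subset _ n
  have hpiece : ∀ n, riemannianMeasure h (Φ '' D n) ≤ ∫⁻ x in D n, J x ∂riemannianMeasure h := by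
    intro n
    refine riemannianMeasure_image_le_lintegral_of_frame_piece h Φ (q (Nat.unpair n).1)
      (q (Nat.unpair n).2) (hDm n)
      (fun x hx ↦ ((hDP n) hx).1.2) (fun x hx ↦ ((hDP n) hx).2)
      (fun x hx ↦ hΦd x ((hDP n) hx).1.1) hJm (fun x hx ↦ hJ x ((hDP n) hx).1.1)
  calc riemannianMeasure h (Φ '' S)
      = riemannianMeasure h (⋃ n, Φ '' D n) := by rw [← image_iUnion, hDS]
    _ ≤ ∑' n, riemannianMeasure h (Φ '' D n) := measure_iUnion_le _
    _ ≤ ∑' n, ∫⁻ x in D n, J x ∂riemannianMeasure h := ENNReal.tsum_le_tsum hpiece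
    _ = ∫⁻ x in ⋃ n, D n, J x ∂riemannianMeasure h :=
        (lintegral_iUnion hDm (disjoint_disjointed _) _).symm
    _ = ∫⁻ x in S, J x ∂riemannianMeasure h := by rw [hDS]

end AreaInequality

end Literature.Geometry.Riemannian
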